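import Literature.Barriers.CriticalPhenomena.PositionSpaceRGNonGibbsianSpacing
import HarnessLib

/-!
# Barrier `PositionSpaceRGNonGibbsian`, Theorem 4.1 (Israel's example, `d = 2`, `b = 2`): the
# `d = 2` instance with the explicit threshold, assembled from the spacing machinery

Companion file of `Literature/Barriers/CriticalPhenomena/PositionSpaceRGNonGibbsian.lean` for the
named fact `NonGibbs.VEFS1993_thm41` (van Enter–Fernández–Sokal 1993, Theorem 4.1: `d = 2`,
decimation `b = 2`, `J > ½ cosh⁻¹(1+√2)`). The generic part of the Griffiths–Pearce–Israel
argument — the printed Step 0 replaced by the DLR equations in a finite volume `W ∋ 0` free of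
other image sites (`ae_le_condExpSpinAtOrigin_of_forall_isingExpect`,
`ae_condExpSpinAtOrigin_le_of_forall_isingExpect`) and the "Conclusion of the argument"
(`not_isQuasilocalMeasure_of_gap`) — is the accepted `PositionSpaceRGNonGibbsianSpacing.lean`
(Theorem 4.3 line; used at `b = 2` also by `PositionSpaceRGNonGibbsianFiniteVolume.lean` for
Theorem 4.2). This file supplies the `d = 2` specifics of Theorem 4.1: the explicit volume
`W_n = Λ^int_{2n+2} ∪ {0}` of §4.1.2 Step 3 (`israelVolume n`), the finite-volume estimate (4.13)
at the EXPLICIT threshold `israelThreshold = ½ cosh⁻¹(1+√2)` as a named fact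
(`VEFS1993_eq413_israel`; the spacing fact `VEFS1993_eq413_spacing` only gives `∃ J₀(d,b)`, and
`VEFS1993_eq413` of the finite-volume file is the `d ≥ 3` statement at `β_c(d-1)`), and the proved
assembly `VEFS1993_thm41_of_eq413_israel : VEFS1993_eq413_israel → VEFS1993_thm41`.

## What the source prints (arXiv:hep-lat/9210032, §4.1.2, pp. 96–101)

* Step 2 (p. 96), eqs. (4.3)–(4.5): "it suffices to show that there exists `δ > 0` such that in
  each neighborhood `𝒩 ∋ ω'_alt` there exist nonempty open sets `𝒩₊, 𝒩₋ ⊂ 𝒩` and constants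
  `c₊ > c₋` with `c₊ - c₋ ≥ δ` such that `⟨σ'_i⟩_{ω'} ≥ c₊` whenever `ω' ∈ 𝒩₊` (4.3a),
  `⟨σ'_i⟩_{ω'} ≤ c₋` whenever `ω' ∈ 𝒩₋` (4.3b)", with `𝒩_± = 𝒩_{R,R',±}` of (4.5) ("`ω' = ω'_alt`
  on `Λ_R`, `ω' = ±1` on `Λ_{R'} ∖ Λ_R`, arbitrary outside `Λ_{R'}`"); "It suffices to show that
  … the Gibbs measure for the modified object system in the finite volume `Λ^int_{R''}`, with
  image spins `ω' ∈ 𝒩_{R,R',+}` (or `𝒩_{R,R',-}`) and arbitrary internal-spin boundary condition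
  … satisfies the bounds (4.3). For simplicity we shall take `R'' = R'`. In fact, in this
  two-dimensional example … we can take `R' = R + 2`"; "choose an even number `R`".
* Step 3 (p. 99): "the system we really want to study is the system consisting of the internal
  spins in `Λ_{R+2}` and the spin at the origin, with the image spins in `Λ^image_R` other than the
  one at the origin fixed in the alternating configuration `ω'_alt`, the image spins in layer
  `Γ^image_{R+2}` set to be `+`, and the spins outside `Λ_{R+2}` (both image and internal) fixed in
  some arbitrary configuration"; (4.13) (p. 100): "`⟨σ_{0,0}⟩̃₊ - ⟨σ_{0,0}⟩̃₋ ≥ δ > 0` uniformly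
  in `R` (sufficiently large) and in the configuration outside `Λ_{R+2}`."
* Conclusion of the argument (p. 101): `A_{R,±} = 𝒩_{R/2;(R/2)+1;±}`, (4.14), "Therefore, what we
  have really proven is that the renormalized measure `μT` is not consistent with any quasilocal
  specification"; **Theorem 4.1** (`J > ½ cosh⁻¹(1+√2) = 0.764285…`, `b = 2`, `d = 2`).

## What is formalised (namespace `Literature.Barriers.CriticalPhenomena.NonGibbs`)

`double` (`x ↦ 2x`), `israelVolume n` (`W_n`) with `zero_mem_israelVolume`,
`two_mul_not_mem_israelVolume` (no other image site lies in `W_n`, the hypothesis `hW` of the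
spacing lemmas); the named fact `VEFS1993_eq413_israel`; the proved assembly
`VEFS1993_thm41_of_eq413_israel`. In image coordinates `R = 2n` is automatically even, `Λ^image_R`
is `box 2 n`, the image layer `Γ^image_{R+2}` is `box 2 (n+1) ∖ box 2 n`, so `𝒩_± =
plusSelected 2 n (n+1)` / `minusSelected 2 n (n+1)` of `PositionSpaceRGNonGibbsianProofs.lean`.

What remains for `VEFS1993_thm41_holds` is exactly `VEFS1993_eq413_israel` (Steps 1–3 of §4.1.2:
dedecoration `J' = ½ log cosh 2J`, FKG/Griffiths reductions, `M₀(J') > 0` for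
`J' > J_c = ½ log(1+√2)`, unfixing (4.7)–(4.12)).
-/

noncomputable section

namespace Literature.Barriers.CriticalPhenomena.NonGibbs

open MeasureTheory Filter Literature.Probability.LatticeModels

/-! ### The volume `W_n` of Step 3 -/

/-- Doubling `x ↦ 2x`: the site of the original lattice `ℤ²` carrying the image spin `σ'_x`
(`σ'_x = σ_{2x}`, eq. (3.7) with `b = 2`). [cite: VanenterFernandezSokal1993, §3.1.2 eq. (3.7)] -/
def double (x : Site 2) : Site 2 := fun i => 2 * x i

/-- `(T₂ σ)_x = σ_{2x}`. [cite: VanenterFernandezSokal1993, §3.1.2 eq. (3.7)] -/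
theorem decimate_two_apply (σ : SpinConfig (Site 2)) (x : Site 2) :
    decimate 2 2 σ x = σ (double x) := by
  simp only [decimate_apply, Nat.cast_ofNat]
  rfl

/-- The dilation of the spacing lemmas at `b = 2` is `double`. [cite: VanenterFernandezSokal1993, §3.1.2 eq. (3.7)] -/
theorem two_mul_eq_double (x : Site 2) : (fun i => ((2 : ℕ) : ℤ) * x i) = double x := by
  funext i; simp [double]

/-- `2 · 0 = 0`. [cite: VanenterFernandezSokal1993, §3.1.2 eq. (3.7)] -/
@[simp] theorem double_zero : double 0 = 0 := by
  funext i; simp [double]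

/-- `2x = 0` only for `x = 0`. [cite: VanenterFernandezSokal1993, §3.1.2 eq. (3.7)] -/
theorem double_eq_zero_iff {x : Site 2} : double x = 0 ↔ x = 0 := by
  constructor
  · intro h; funext i
    have := congr_fun h i
    simpa [double] using this
  · rintro rfl; exact double_zero

/-- Image sites `2x` have even coordinates (they are never internal sites).
[cite: VanenterFernandezSokal1993, §4.1.2 (image spins: both coordinates even)] -/
theorem even_double_apply (x : Site 2) (i : Fin 2) : Even (double x i) :=
  ⟨x i, by simp [double, two_mul]⟩

/-- **The finite volume of Step 3**, `W_n = Λ^int_{R+2} ∪ {0}` with `R = 2n`: the internal sites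
(not both coordinates even) of the square `Λ_{2n+2} = box 2 (2n+2)` together with the origin —
"the system consisting of the internal spins in `Λ_{R+2}` and the spin at the origin", all other
spins (the image spins of `Λ_{R+2}` and everything outside) being boundary condition.
[cite: VanenterFernandezSokal1993, §4.1.2 Step 3] -/
def israelVolume (n : ℕ) : Finset (Site 2) :=
  open Classical in (box 2 (2 * n + 2)).filter fun y => y = 0 ∨ ¬ ∀ i, Even (y i)

/-- Membership in `W_n`. [cite: VanenterFernandezSokal1993, §4.1.2 Step 3] -/
theorem mem_israelVolume_iff {n : ℕ} {y : Site 2} :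
    y ∈ israelVolume n ↔ y ∈ box 2 (2 * n + 2) ∧ (y = 0 ∨ ¬ ∀ i, Even (y i)) := by
  classical
  simp [israelVolume, Finset.mem_filter]

/-- The origin is resampled in `W_n` ("unfixing of the spin at the origin"); the hypothesis `h0`
of the spacing lemmas. [cite: VanenterFernandezSokal1993, §4.1.2 Step 3] -/
theorem zero_mem_israelVolume (n : ℕ) : (0 : Site 2) ∈ israelVolume n :=
  mem_israelVolume_iff.2 ⟨zero_mem_box 2 _, Or.inl rfl⟩

/-- Nonzero image sites `2x`, `x ≠ 0`, are NOT in `W_n`: they are boundary condition (conditioned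
upon). [cite: VanenterFernandezSokal1993, §4.1.2 Steps 0 and 3] -/
theorem double_not_mem_israelVolume {n : ℕ} {x : Site 2} (hx : x ≠ 0) :
    double x ∉ israelVolume n := by
  rw [mem_israelVolume_iff]
  rintro ⟨-, h | h⟩
  · exact hx (double_eq_zero_iff.1 h)
  · exact h (even_double_apply x)

/-- The same in the form of the hypothesis `hW` of the spacing lemmas (`b = 2`): `W_n` contains no
image site `2x` other than the origin. [cite: VanenterFernandezSokal1993, §4.1.2 Steps 0 and 3] -/
theorem two_mul_not_mem_israelVolume (n : ℕ) :
    ∀ x : Site 2, x ≠ 0 → (fun i => ((2 : ℕ) : ℤ) * x i) ∉ israelVolume n := fun x hx => by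
  rw [two_mul_eq_double]
  exact double_not_mem_israelVolume hx

/-! ### The named fact: the finite-volume estimate (4.13) at the explicit threshold -/

/-- **van Enter–Fernández–Sokal 1993, §4.1.2, eqs. (4.3)–(4.5) (p. 96) with Step 3, eq. (4.13)**
(the outcome of Steps 1–3 of Israel's example, in the finite-volume, uniform-in-the-boundary-
condition form of p. 96). For every coupling `β > ½ cosh⁻¹(1+√2)` (`israelThreshold`) there are
`δ > 0` and `n₀` such that for every `n ≥ n₀` (`R = 2n` "even", "sufficiently large";
`R' = R + 2`, i.e. `n + 1` in image coordinates) there are levels `c₊ - c₋ ≥ δ` with: for EVERY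
boundary condition `η` of the two-dimensional zero-field nearest-neighbour Ising model whose
decimation `T₂η` lies in `𝒩_{n,n+1,+}` (image spins `ω'_alt` on `Λ'_n`, `+1` on the annulus
`Λ'_{n+1} ∖ Λ'_n`, everything else — image spins further out and all internal spins — arbitrary),
the finite-volume Gibbs expectation of `σ_{0,0}` in the volume `W_n = Λ^int_{2n+2} ∪ {0}` is
`≥ c₊`; and `≤ c₋` whenever `T₂η ∈ 𝒩_{n,n+1,-}` — printed as (4.3a/b) "`⟨σ'_i⟩_{ω'} ≥ c₊`
whenever `ω' ∈ 𝒩₊`, `≤ c₋` whenever `ω' ∈ 𝒩₋`", "`c₊ > c₋` with `c₊ - c₋ ≥ δ`", to be shown for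
"the Gibbs measure for the modified object system in the finite volume … with image spins
`ω' ∈ 𝒩_{R,R',±}` and arbitrary internal-spin boundary condition" (p. 96), for the Step-3 system
"consisting of the internal spins in `Λ_{R+2}` and the spin at the origin" (p. 99), the gap being
(4.13): "`⟨σ_{0,0}⟩̃₊ - ⟨σ_{0,0}⟩̃₋ ≥ δ > 0` uniformly in `R` (sufficiently large) and in the
configuration outside `Λ_{R+2}`". (The value of `η` at the origin is irrelevant, `0 ∈ W_n`; it is
pinned to `+1 = ω'_alt(0)` by `𝒩_{n,n+1,±}`.) Same shape as `VEFS1993_eq413_spacing` (which only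
asserts `∃ J₀(d,b)`) and `VEFS1993_eq413` (the `d ≥ 3` statement at `β_c(d-1)`), here with the
explicit threshold and volume of Theorem 4.1. Its printed proof: Step 1 (dedecoration,
`J' = ½ log cosh 2J > J_c = ½ log(1+√2)`), Step 2 (FKG / Griffiths II reductions to a
`+`-boundary Ising square at coupling `J'`, spontaneous magnetisation `M₀(J') > 0`, eq. (4.6)),
Step 3 ((4.7)–(4.12), Griffiths I). Named fact, not proved here.
[cite: VanenterFernandezSokal1993, §4.1.2 eqs. (4.3)–(4.5) p. 96 and eq. (4.13)] -/
def VEFS1993_eq413_israel : Prop :=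
  ∀ β : ℝ, israelThreshold < β →
    ∃ δ : ℝ, 0 < δ ∧ ∃ n₀ : ℕ, ∀ n : ℕ, n₀ ≤ n → ∃ cplus cminus : ℝ, δ ≤ cplus - cminus ∧
      (∀ η : SpinConfig (Site 2), decimate 2 2 η ∈ plusSelected 2 n (n + 1) →
        cplus ≤ isingExpect (zdGraph 2) (israelVolume n) β 0 (.fixed η) (spinAt 0)) ∧
      (∀ η : SpinConfig (Site 2), decimate 2 2 η ∈ minusSelected 2 n (n + 1) →
        isingExpect (zdGraph 2) (israelVolume n) β 0 (.fixed η) (spinAt 0) ≤ cminus)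

/-! ### Assembly: Theorem 4.1 from the estimate (4.13) -/

/-- **Reduction of Theorem 4.1 to the finite-volume estimate (4.13)** (van Enter–Fernández–Sokal
§4.1.2, Step 0 and "Conclusion of the argument"), assembled from the spacing machinery at `b = 2`,
`W = W_n`: the uniform finite-volume bounds pass to a.e. bounds on `E_{μT₂}(σ'_0 | {σ'_x}_{x≠0})`
on `𝒩_{n,n+1,±}` (`ae_le_condExpSpinAtOrigin_of_forall_isingExpect` and its mirror — the DLR
equations of `μ` in `W_n`, which contains the origin and no other image site), the sets
`𝒩_{n₀+k,n₀+k+1,±}` are charged by `μT₂` (`map_decimate_plusSelected_pos`) and agree with `ω'_alt`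
on `box 2 k`, so `not_isQuasilocalMeasure_of_gap` excludes every quasilocal (Feller)
specification for `μT₂` — Theorem 4.1. [cite: VanenterFernandezSokal1993, Theorem 4.1, §4.1.2 eqs. (4.13)–(4.14) and Conclusion of the argument] -/
theorem VEFS1993_thm41_of_eq413_israel (h413 : VEFS1993_eq413_israel) : VEFS1993_thm41 := by
  intro β hβ μ hμ
  obtain ⟨δ, hδ, n₀, hn⟩ := h413 β hβ
  choose cp cm hgap hplus hminus using fun k : ℕ => hn (n₀ + k) (Nat.le_add_right n₀ k)
  refine not_isQuasilocalMeasure_of_gap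
    (fun k => plusSelected 2 (n₀ + k) (n₀ + k + 1)) (fun k => minusSelected 2 (n₀ + k) (n₀ + k + 1))
    (fun k ω hω x hx => eqOn_box_of_mem_plusSelected hω x (box_mono 2 (Nat.le_add_left k n₀) hx))
    (fun k ω hω x hx => eqOn_box_of_mem_minusSelected hω x (box_mono 2 (Nat.le_add_left k n₀) hx))
    (fun k => (map_decimate_plusSelected_pos hμ _ _).ne')
    (fun k => (map_decimate_minusSelected_pos hμ _ _).ne') hδ cp cm hgap
    (fun k => ?_) (fun k => ?_)
  · exact ae_le_condExpSpinAtOrigin_of_forall_isingExpect (b := 2) (by norm_num) hμ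
      (zero_mem_israelVolume (n₀ + k)) (two_mul_not_mem_israelVolume (n₀ + k)) (hplus k)
  · exact ae_condExpSpinAtOrigin_le_of_forall_isingExpect (b := 2) (by norm_num) hμ
      (zero_mem_israelVolume (n₀ + k)) (two_mul_not_mem_israelVolume (n₀ + k)) (hminus k)

end Literature.Barriers.CriticalPhenomena.NonGibbs

end
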